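/-
Copyright: statement-level skeleton of a published paper (lit-balaban cell, Phase-2 proof seat p19, gen 2). No claims beyond
what the kernel checks below.
-/
import Mathlib
import Literature.MathematicalPhysics.QuantumFieldTheory.Balaban1983to89.B3Ineq215Instance
import Literature.MathematicalPhysics.QuantumFieldTheory.Balaban1983to89.B3

/-!
# B3 — T. Bałaban, *(Higgs)₂,₃ quantum fields in a finite volume. III. Renormalization*, CMP **88** (1983) 411–445
[Balaban1983Higgs3] — p. 427: *"To prove the theorem it is sufficient to prove (2.15)"* — the assembly (2.13) ∧ (2.15) ⇒
the bound of Proposition 2.1 for a fixed ordering, PROVED as bookkeeping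

statement-level skeleton of published theorems with citation tags; proofs where landed; nothing here is a claim about
the Yang–Mills mass gap

PDF held: `paper:balaban1983-higgs-2-3-quantum-fields-finite-volume` (journal page = PDF page + 410); renders
`pub-balaban/b2b-balaban-ref1/pages/1983-cmp88-higgs23-III/1983-cmp88-higgs23-III-p016, p017-x2.png` (pp. 426, 427).

Part of the Phase-2 proof of SKELETON rows **B3.Eq2.13-2.14 / B3.Eq2.15-2.16** (unit `lit-balaban-p19` gen 2; HOME
`run/shared/lean/pub/lit-balaban/`), after `B3Ineq215Proof` ((2.15), `Model.ineq215_of_pos`) and `B3Ineq215Instance`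
(r15's carrier `B3Sect2FirstEstimate.ScaledGraph` instantiated per scale assignment, `Counts.sum_Etilde_le`).

WHAT IS REPRODUCED.  p. 426–427 [PDF 16–17]: the first estimate **(2.13)** bounds `|Σ_{j∈J(l̃)} E(G(j), {□(v)}, Φ′_ext,
A_ext)|` by `O(1)(e(L^kε))^{d_v(G)}(λ(L^kε))^{d_s(G)} exp[−(δ₁/2)d({□(v)})] ‖hΦ_ext‖₁‖h′A_ext‖₁ Σ_{j∈J(l̃)} Ẽ(G(j), {□(v)})`
and *"To prove the theorem it is sufficient to prove that Σ_{j∈J(l̃)} Σ_{{Δ(v)}} Ẽ(G(j), {Δ(v)}) ≦ O(1) (2.15)"* — i.e.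
(2.13) termwise (it IS obtained termwise: absolute values of all factors, p. 426) together with (2.15) gives the bound of
Proposition 2.1 / (1.33) for the sum over the fixed ordering l̃, with `O(1) · const215`.  KERNEL-CHECKED here in exactly
that form: the ANALYTIC input (2.13) — r15's typed `B3Sect2FirstEstimate.Ineq213`, per assignment `j` on the carrier
`Counts.toScaledGraph k j □` — is a HYPOTHESIS (it rests on (2.5), (2.10)–(2.12), the estimates of B4 = CMP 89, not
formalized); the combinatorial input (2.15) is the landed theorem; the output is the (1.33)-shaped bound
(`Counts.bound133_of_ineq213`).  The remaining printed step to Proposition 2.1 — summing over the `m!` orderings l̃ via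
(2.7) — is r15's landed `B3.sum_le_card_orderings_nsmul`.  Nothing beyond this bookkeeping is asserted; in particular
this file does NOT prove Proposition 2.1 (whose analytic content is (2.13)).

v1.1 (same seat, append-only): the printed index sets **J(l̃)** of (2.6)–(2.7) pp. 424–425 as typed in `B3.lean`
(`B3.OrderedAlong σ j` = *"j_{l(1)} ≤ j_{l(2)} ≤ … ≤ j_{l(m)}"*, `B3.Assignment` = the three printed requirements on
l̃ ↦ J(l̃), multi-indices `j : Fin m → Fin k`) feed the landed (2.15): for the model listing the lines along l̃ = σ, every
`j ∈ J(l̃)` read in ℕ along σ is a member of `Model.Mon m k` (`Model.mem_Mon_of_orderedAlong`), distinct members of J(l̃)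
stay distinct, the weights are non-negative, hence `Σ_{j∈J(l̃)} Σ_{{Δ(v)}} Ẽ ≤ const215` for ANY admissible choice of
J(l̃) (`Model.ineq215_of_orderedAlong`, `Model.ineq215_assignment`), not only for the maximal one `Model.Mon m k` used in
`B3Ineq215Proof`.  (The last printed step, the sum over the m! orderings (2.7) with r15's `B3.sum_le_card_orderings_nsmul`,
needs one `Model` per ordering; it is not restated here.)
-/

open Finset

namespace Literature.MathematicalPhysics.QuantumFieldTheory.Balaban1983to89.B3Ineq215

open B3Sect2FirstEstimate

namespace Counts

variable {V : Type} [Fintype V] [DecidableEq V] {m : ℕ} (C : Counts V m)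

/-- p. 427 [PDF 17]: *"To prove the theorem it is sufficient to prove that Σ_{j∈J(l̃)} Σ_{{Δ(v)}} Ẽ(G(j), {Δ(v)}_{v∈G}) ≦
O(1) (2.15)"* — PROVED as the assembly it is: if the first estimate (2.13) holds for each scale assignment `j ∈ J(l̃)`
(r15's `Ineq213` on the carrier of that assignment, with the values `Eval j = E(G(j), {□(v)}, Φ′_ext, A_ext)` and the
printed prefactor data), and every connected component of every `G_i` has positive degree (so that (2.15) holds,
`sum_Etilde_le`), then `|Σ_{j∈J(l̃)} E(G(j), …)| ≤ O(1)·const215 · (e(L^kε))^{d_v}(λ(L^kε))^{d_s} e^{−(δ₁/2)d({□(v)})}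
‖hΦ_ext‖₁‖h′A_ext‖₁` — the bound (1.33) for the fixed ordering l̃, for every `k` and all unit cubes.
[cite: Balaban1983Higgs3, (2.15) p.427] -/
theorem bound133_of_ineq213
    (hpos : ∀ i, i ≤ m → ∀ b ∈ C.toModel.reps i, C.toModel.Nontriv i b → 0 < C.toModel.D i b)
    (k : ℕ) (box : V → Fin C.d → ℕ) {C₀ eRun lamRun dtree normPhi normA : ℝ} {dv ds : ℕ}
    (hC₀ : 0 ≤ C₀) (he : 0 ≤ eRun) (hl : 0 ≤ lamRun) (hΦ : 0 ≤ normPhi) (hA : 0 ≤ normA)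
    (Eval : (Fin m → ℕ) → ℝ)
    (h213 : ∀ j ∈ Model.Mon m k, Ineq213 (C.toScaledGraph k j box) C₀ {j} Eval eRun lamRun dv ds dtree normPhi normA) :
    |∑ j ∈ Model.Mon m k, Eval j|
      ≤ C₀ * C.toModel.const215 * (eRun ^ dv * lamRun ^ ds * Real.exp (-(C.δ₁ / 2 * dtree)) * normPhi * normA) := by
  -- the common prefactor
  set P : ℝ := eRun ^ dv * lamRun ^ ds * Real.exp (-(C.δ₁ / 2 * dtree)) * normPhi * normA with hP
  have hP0 : 0 ≤ P := by rw [hP]; positivity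
  -- (2.13) termwise
  have hterm : ∀ j ∈ Model.Mon m k, |Eval j| ≤ C₀ * P * (C.toScaledGraph k j box).Etilde j := by
    intro j hj
    have h := h213 j hj
    unfold Ineq213 at h
    rw [Finset.sum_singleton, Finset.sum_singleton] at h
    have e : C₀ * eRun ^ dv * lamRun ^ ds * Real.exp (-((C.toScaledGraph k j box).δ₁ / 2 * dtree)) * normPhi * normA
        * (C.toScaledGraph k j box).Etilde j = C₀ * P * (C.toScaledGraph k j box).Etilde j := by
      rw [hP]; simp only [toScaledGraph]; ring
    rw [e] at h
    exact h
  calc |∑ j ∈ Model.Mon m k, Eval j| ≤ ∑ j ∈ Model.Mon m k, |Eval j| := Finset.abs_sum_le_sum_abs _ _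
    _ ≤ ∑ j ∈ Model.Mon m k, C₀ * P * (C.toScaledGraph k j box).Etilde j := Finset.sum_le_sum hterm
    _ = C₀ * P * ∑ j ∈ Model.Mon m k, (C.toScaledGraph k j box).Etilde j := by rw [Finset.mul_sum]
    _ ≤ C₀ * P * C.toModel.const215 :=
        mul_le_mul_of_nonneg_left (C.sum_Etilde_le hpos k box) (mul_nonneg hC₀ hP0)
    _ = C₀ * C.toModel.const215 * P := by ring

end Counts

/-! ## v1.1 — the printed index sets `J(l̃)` of (2.6)–(2.7) (`B3.OrderedAlong`, `B3.Assignment`) feed (2.15) -/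

namespace Model

variable {V : Type} [Fintype V] [DecidableEq V] {m : ℕ} (M : Model V m)

/-- p. 424 [PDF 14]: *"a sum over indices j satisfying the condition j_{l(1)} ≤ j_{l(2)} ≤ … ≤ j_{l(m)}"* — a multi-index
`j : Fin m → Fin k` (indexed by the lines of `G`) ordered along l̃ = `σ` (`B3.OrderedAlong σ j`), read in ℕ along the
listing `l ↦ σ l` of the lines, is a member of the index set `Model.Mon m k` of `B3Ineq215Proof` (monotone, values `< k`).
[cite: Balaban1983Higgs3, (2.7) p.424] -/
theorem mem_Mon_of_orderedAlong {k : ℕ} {σ : Equiv.Perm (Fin m)} {j : Fin m → Fin k} (hj : B3.OrderedAlong σ j) :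
    (fun l => ((j (σ l) : Fin k) : ℕ)) ∈ Mon m k := by
  rw [mem_Mon]
  refine ⟨fun a b hab => ?_, fun l => (j (σ l)).isLt⟩
  have h := hj hab
  simpa using h

/-- **(2.15) over a printed index set J(l̃).**  Let the model `M` list the lines of `G` along the ordering l̃ = `σ` (line
`l` of `M` is the line `σ l` of `G`), and let `J` be any finite set of multi-indices `j : Fin m → Fin k` ordered along
`σ` (p. 424: *"we assign some set J(l̃) of the indices j satisfying the condition j_{l(1)} ≤ … ≤ j_{l(m)}"*).  If every
connected component of every `G_i` has positive degree, then `Σ_{j∈J} Σ_{{Δ(v)}} Ẽ(G(j), {Δ(v)}) ≤ const215`, uniformly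
in `k` and in the unit cubes: the members of `J` read along `σ` are distinct members of `Model.Mon m k`, the weights are
non-negative (`W_nonneg`), and `ineq215_of_pos` bounds the sum over all of `Model.Mon m k`.
[cite: Balaban1983Higgs3, (2.15) p.427] -/
theorem ineq215_of_orderedAlong
    (hpos : ∀ i, i ≤ m → ∀ b ∈ M.reps i, M.Nontriv i b → 0 < M.D i b) (k : ℕ) (box : V → Fin M.d → ℕ)
    (σ : Equiv.Perm (Fin m)) (J : Finset (Fin m → Fin k)) (hJ : ∀ j ∈ J, B3.OrderedAlong σ j) :
    ∑ j ∈ J, M.W 0 k (fun l => ((j (σ l) : Fin k) : ℕ)) box ≤ M.const215 := by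
  classical
  -- reading a multi-index in ℕ along σ is injective
  have hinj : Set.InjOn (fun (j : Fin m → Fin k) (l : Fin m) => ((j (σ l) : Fin k) : ℕ)) ↑J := by
    intro j _ j' _ h
    funext l
    have e := congrFun h (σ.symm l)
    simp only [Equiv.apply_symm_apply] at e
    exact Fin.ext e
  calc ∑ j ∈ J, M.W 0 k (fun l => ((j (σ l) : Fin k) : ℕ)) box
      = ∑ j' ∈ J.image (fun (j : Fin m → Fin k) (l : Fin m) => ((j (σ l) : Fin k) : ℕ)), M.W 0 k j' box := by
        rw [Finset.sum_image hinj]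
    _ ≤ ∑ j' ∈ Mon m k, M.W 0 k j' box := by
        apply Finset.sum_le_sum_of_subset_of_nonneg
        · intro j' hj'
          obtain ⟨j, hj, rfl⟩ := Finset.mem_image.1 hj'
          exact mem_Mon_of_orderedAlong (hJ j hj)
        · intro j' _ _
          exact M.W_nonneg 0 k j' box
    _ ≤ M.const215 := M.ineq215_of_pos hpos k box

/-- The same at the identity ordering (the lines of `G` already listed along l̃, `B3.OrderedAlong 1 j` = `j` monotone):
`Σ_{j∈J} Σ_{{Δ(v)}} Ẽ(G(j), {Δ(v)}) ≤ const215` for every finite set `J` of monotone `Fin k`-valued multi-indices.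
[cite: Balaban1983Higgs3, (2.15) p.427] -/
theorem ineq215_of_orderedAlong_one
    (hpos : ∀ i, i ≤ m → ∀ b ∈ M.reps i, M.Nontriv i b → 0 < M.D i b) (k : ℕ) (box : V → Fin M.d → ℕ)
    (J : Finset (Fin m → Fin k)) (hJ : ∀ j ∈ J, B3.OrderedAlong 1 j) :
    ∑ j ∈ J, M.W 0 k (fun l => ((j l : Fin k) : ℕ)) box ≤ M.const215 := by
  simpa using M.ineq215_of_orderedAlong hpos k box 1 J hJ

/-- pp. 424–425: *"Thus for each ordering l̃ we assign some set J(l̃) of the indices j satisfying the condition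
j_{l(1)} ≤ j_{l(2)} ≤ … ≤ j_{l(m)} in such a way that ⋃_{l̃} J(l̃) is the set of all indices and the components of
this union are disjoint sets"* (`B3.Assignment`) — for EVERY such assignment family `A` and every ordering l̃ = `σ`,
(2.15) holds over the printed `J(l̃) = A.J σ` for the model listing the lines along `σ`, with the same constant.
[cite: Balaban1983Higgs3, (2.15) p.427] -/
theorem ineq215_assignment
    (hpos : ∀ i, i ≤ m → ∀ b ∈ M.reps i, M.Nontriv i b → 0 < M.D i b) (k : ℕ) (box : V → Fin M.d → ℕ)
    (A : B3.Assignment m k) (σ : Equiv.Perm (Fin m)) :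
    ∑ j ∈ A.J σ, M.W 0 k (fun l => ((j (σ l) : Fin k) : ℕ)) box ≤ M.const215 :=
  M.ineq215_of_orderedAlong hpos k box σ (A.J σ) (A.ordered σ)

end Model

end Literature.MathematicalPhysics.QuantumFieldTheory.Balaban1983to89.B3Ineq215
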